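import Mathlib
import Literature.MathematicalPhysics.MHD.SolovevFluxSurfaceAverages
import Literature.MathematicalPhysics.MHD.FluxSurfaceAverage
import HarnessLib

/-!
# Jardin's surface averages (5.30) on the Lee–Cerfon / PCF Solov'ev family as explicit one-dimensional
# integrals: the per-surface averages `⟨B²/|∇ψ|²⟩, ⟨1/|∇ψ|²⟩, ⟨1/B²⟩, ⟨1/(B²|∇ψ|²)⟩, ⟨R⁻²⟩` of the
# Glasser–Greene–Johnson (Jardin (8.134)) form of Mercier's criterion (proved)

Fifth file of the `lcLoop` series (gridfusion-model-5). Objects: the Lee–Cerfon/CHEASE Solov'ev solution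
`Ψ = psiLC κ F_B R₀ q₀ a` [Lee–Cerfon 2015 §4.1 (solo2), bib `LeeCerfon2015`] — of which every shape-fitted
Pataki–Cerfon–Freidberg equilibrium is a member (`psiPCF_eq_LCform`) — and its PRINTED flux-surface loop
`lcLoop R₀ κ r` (`u = R² = R₀² + 2rR₀cos t`, `c = κF_B/(2R₀³q₀)`, surfaces `0 < r < R₀/2`).

Jardin, *Computational Methods in Plasma Physics* (2010) §8.5 eq. (8.134) [galaxy:panama:478966162915417
c556000–572000, read on the page] needs, per surface and for an arbitrary label `ψ`, the surface averages
(5.30) `⟨B²/|∇ψ|²⟩, ⟨σB²/|∇ψ|²⟩, ⟨σ²B²/|∇ψ|²⟩, ⟨1/B²⟩` (besides `V′, V″, Φ′, Φ″, Ψ′, Ψ″, I′, K′, p′`).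
With the functional `GradShafranov.surfaceAverageE` of `FluxSurfaceAverage.lean` (label `ψ := Ψ`) this
file PROVES, generically in `(κ, F_B, R₀, q₀, a, r)`:

* `surfaceAverageE_lcLoop` — for ANY scalar `f`, `⟨f⟩ = ∫₀^{2π} f(γ(t)) w(t) dt ÷ ∫₀^{2π} w(t) dt` with the
  explicit density `w = lcAvgWeight = κ/(2c√u)` of `dℓ/B_p` (Jardin's `J dθ`, (5.23)); `∫₀^{2π} w dt > 0`
  and `V′ = 2π∫₀^{2π} w dt > 0` (every surface of the family is regular);
* the GGJ integrands along the loop: `|∇Ψ|² = lcGradSq` (`SolovevFluxSurfaceMercier.lean`) and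
  `B² = (g² + lcGradSq)/u` for a constant free function `F ≡ g` (`fieldBsq_lcLoop`; for the GS-consistent
  member `g = F_B`, but the identity is pure algebra), hence `⟨1/|∇Ψ|²⟩, ⟨B²/|∇Ψ|²⟩, ⟨1/B²⟩,
  ⟨1/(B²|∇Ψ|²)⟩` and `⟨R⁻²⟩` as ratios of explicit `t`-integrals. `σB² = J·B` is a SURFACE CONSTANT for
  Solov'ev profiles, so `⟨σB²/|∇ψ|²⟩ = (σB²)⟨1/|∇ψ|²⟩`, `⟨σ²B²/|∇ψ|²⟩ = (σB²)²⟨1/(B²|∇ψ|²)⟩` by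
  `GradShafranov.surfaceAverageE_of_const_mul`; the value and sign of `σ` is Jardin's (8.50), typed with the
  criterion (gridfusion-lit-3) — deliberately NOT fixed here.

The label-derivatives `V″`, `dq/dr` (`Φ″ = 2π dq/dΨ`) are in `SolovevFluxSurfaceGGJDerivs.lean`.
HONEST FRAMING (three columns): exact real analysis about MODEL objects (ideal MHD, Solov'ev profiles,
analytic fixed boundary); certified enclosures of these integrals on named surfaces are a Bench matter
(two quadrature lineages); nothing here says anything is stable. Typer/prover: gridfusion-model-5 (g3), 2026-08-27.
-/

noncomputable section

namespace Literature.MathematicalPhysics.MHD.Solovev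

open GradShafranov FluxGeometry _root_.Real MeasureTheory intervalIntegral _root_.Set

/-! ## The surface-average density along the printed loop -/

/-- `w(t) = κ/(2c√u)`, `c = κF_B/(2R₀³q₀)`, `u = R₀² + 2rR₀cos t`: the density of `dℓ/B_p` — Jardin's `J dθ`
(5.23) — with respect to `dt` along `lcLoop R₀ κ r` (`lcLoop_volumeIntegrand`).
[cite: LeeCerfon2015, §4.1 (boundary parametrisation)] -/
def lcAvgWeight (κ FB R₀ q₀ r t : ℝ) : ℝ :=
  κ / (2 * (κ * FB / (2 * R₀ ^ 3 * q₀)) * Real.sqrt (lcU R₀ r t))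

/-- Simplified form `w = (R₀³q₀/F_B)·(√u)⁻¹` (`κ, F_B, R₀, q₀ ≠ 0`). [cite: LeeCerfon2015, §4.1 (boundary parametrisation)] -/
theorem lcAvgWeight_eq {κ FB R₀ q₀ : ℝ} (hκ : κ ≠ 0) (hFB : FB ≠ 0) (hR₀ : R₀ ≠ 0) (hq₀ : q₀ ≠ 0)
    {r t : ℝ} (hu : 0 < lcU R₀ r t) :
    lcAvgWeight κ FB R₀ q₀ r t = R₀ ^ 3 * q₀ / FB * (Real.sqrt (lcU R₀ r t))⁻¹ := by
  have hs : Real.sqrt (lcU R₀ r t) ≠ 0 := (Real.sqrt_pos.2 hu).ne'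
  unfold lcAvgWeight
  field_simp

/-- `w > 0` on every surface `0 ≤ r < R₀/2` (`κ, F_B, q₀, R₀ > 0`). [cite: LeeCerfon2015, §4.1 (boundary parametrisation)] -/
theorem lcAvgWeight_pos {R₀ κ FB q₀ r : ℝ} (hR₀ : 0 < R₀) (hκ : 0 < κ) (hFB : 0 < FB) (hq₀ : 0 < q₀)
    (hr : 0 ≤ r) (h2r : 2 * r < R₀) (t : ℝ) : 0 < lcAvgWeight κ FB R₀ q₀ r t := by
  have hs : 0 < Real.sqrt (lcU R₀ r t) := Real.sqrt_pos.2 (lcU_pos hR₀ hr h2r t)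
  unfold lcAvgWeight
  positivity

/-- `t ↦ w(t)` is continuous. [cite: LeeCerfon2015, §4.1 (boundary parametrisation)] -/
theorem continuous_lcAvgWeight {R₀ κ FB q₀ r : ℝ} (hR₀ : 0 < R₀) (hκ : 0 < κ) (hFB : 0 < FB)
    (hq₀ : 0 < q₀) (hr : 0 ≤ r) (h2r : 2 * r < R₀) : Continuous (lcAvgWeight κ FB R₀ q₀ r) := by
  have hc : Continuous (lcU R₀ r) := by unfold lcU; fun_prop
  unfold lcAvgWeight
  refine continuous_const.div (continuous_const.mul hc.sqrt) fun t => ?_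
  have hs : 0 < Real.sqrt (lcU R₀ r t) := Real.sqrt_pos.2 (lcU_pos hR₀ hr h2r t)
  positivity

/-- `∫₀^{2π} w dt > 0`. [cite: LeeCerfon2015, §4.1 (boundary parametrisation)] -/
theorem integral_lcAvgWeight_pos {R₀ κ FB q₀ r : ℝ} (hR₀ : 0 < R₀) (hκ : 0 < κ) (hFB : 0 < FB)
    (hq₀ : 0 < q₀) (hr : 0 ≤ r) (h2r : 2 * r < R₀) :
    0 < ∫ t in (0 : ℝ)..(2 * π), lcAvgWeight κ FB R₀ q₀ r t :=
  intervalIntegral_pos_of_pos_on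
    ((continuous_lcAvgWeight hR₀ hκ hFB hq₀ hr h2r).intervalIntegrable _ _)
    (fun t _ => lcAvgWeight_pos hR₀ hκ hFB hq₀ hr h2r t) (by positivity)

/-- `V′ = 2π∫₀^{2π} w dt` (restating `volumeDerivE_lcLoop` with the named density).
[cite: Freidberg2014, §6.3.2 eq. (6.22)] -/
theorem volumeDerivE_lcLoop_eq {R₀ κ FB q₀ r : ℝ} (hR₀ : 0 < R₀) (hκ : 0 < κ) (hFB : 0 < FB)
    (hq₀ : 0 < q₀) (hr : 0 < r) (h2r : 2 * r < R₀) (a : ℝ) :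
    volumeDerivE (psiLC κ FB R₀ q₀ a) (lcLoop R₀ κ r) (2 * π)
      = 2 * π * ∫ t in (0 : ℝ)..(2 * π), lcAvgWeight κ FB R₀ q₀ r t :=
  volumeDerivE_lcLoop hR₀ hκ hFB hq₀ hr h2r a

/-- `V′ > 0` on every surface of the family (a regular surface: the hypothesis of the `⟨·⟩` algebra).
[cite: Freidberg2014, §6.3.2 eq. (6.22)] -/
theorem volumeDerivE_lcLoop_pos {R₀ κ FB q₀ r : ℝ} (hR₀ : 0 < R₀) (hκ : 0 < κ) (hFB : 0 < FB)
    (hq₀ : 0 < q₀) (hr : 0 < r) (h2r : 2 * r < R₀) (a : ℝ) :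
    0 < volumeDerivE (psiLC κ FB R₀ q₀ a) (lcLoop R₀ κ r) (2 * π) := by
  rw [volumeDerivE_lcLoop_eq hR₀ hκ hFB hq₀ hr h2r a]
  exact mul_pos (by positivity) (integral_lcAvgWeight_pos hR₀ hκ hFB hq₀ hr.le h2r)

/-! ## Surface averages on the printed loop -/

/-- **Jardin's surface average (5.30) on the printed Lee–Cerfon loop is a ratio of explicit one-dimensional
integrals:** for ANY scalar `f(R, Z)` and every surface `0 < r < R₀/2`,
`⟨f⟩ = ∫₀^{2π} f(γ(t))·w(t) dt ÷ ∫₀^{2π} w(t) dt`, `w = κ/(2c√u)`. [cite: Jardin2010, §5.3 eq. (5.30)] -/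
theorem surfaceAverageE_lcLoop {R₀ κ FB q₀ r : ℝ} (hR₀ : 0 < R₀) (hκ : 0 < κ) (hFB : 0 < FB)
    (hq₀ : 0 < q₀) (hr : 0 < r) (h2r : 2 * r < R₀) (a : ℝ) (f : ℝ → ℝ → ℝ) :
    surfaceAverageE (psiLC κ FB R₀ q₀ a) (lcLoop R₀ κ r) (2 * π) f
      = (∫ t in (0 : ℝ)..(2 * π), f (lcLoop R₀ κ r t).1 (lcLoop R₀ κ r t).2 * lcAvgWeight κ FB R₀ q₀ r t)
          / ∫ t in (0 : ℝ)..(2 * π), lcAvgWeight κ FB R₀ q₀ r t := by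
  unfold surfaceAverageE
  rw [volumeDerivE_lcLoop_eq hR₀ hκ hFB hq₀ hr h2r a]
  unfold loopIntegralE
  have e : ∫ t in (0 : ℝ)..(2 * π), f (lcLoop R₀ κ r t).1 (lcLoop R₀ κ r t).2
        / fieldBpol (psiLC κ FB R₀ q₀ a) (lcLoop R₀ κ r t).1 (lcLoop R₀ κ r t).2 * speed (lcLoop R₀ κ r) t
      = ∫ t in (0 : ℝ)..(2 * π), f (lcLoop R₀ κ r t).1 (lcLoop R₀ κ r t).2 * lcAvgWeight κ FB R₀ q₀ r t :=
    intervalIntegral.integral_congr fun t _ => by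
      rw [div_eq_mul_one_div, mul_assoc, lcLoop_volumeIntegrand hR₀ hκ hFB hq₀ hr h2r a t]
      rfl
  rw [e, mul_div_mul_left _ _ (by positivity : (2 : ℝ) * π ≠ 0)]

/-- `B² = (g² + |∇Ψ|²)/u` along the loop for a CONSTANT free function `F ≡ g` (`u = R²`;
`|∇Ψ|² = lcGradSq`). [cite: Freidberg2014, §12.3 eq. (12.32)] -/
theorem fieldBsq_lcLoop {R₀ κ r : ℝ} (hR₀ : 0 < R₀) (hκ : κ ≠ 0) (hr : 0 ≤ r) (h2r : 2 * r < R₀)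
    (g FB q₀ a t : ℝ) :
    fieldBsq (fun _ => g) (psiLC κ FB R₀ q₀ a) (lcLoop R₀ κ r t).1 (lcLoop R₀ κ r t).2
      = (g ^ 2 + lcGradSq κ FB R₀ q₀ r t) / lcU R₀ r t := by
  have hu := lcU_pos hR₀ hr h2r t
  have hs : 0 < Real.sqrt (lcU R₀ r t) := Real.sqrt_pos.2 hu
  have h1 : (lcLoop R₀ κ r t).1 = Real.sqrt (lcU R₀ r t) := rfl
  rw [fieldBsq_const _ _ (by rw [h1]; exact hs.ne'), gradSq_psiLC_lcLoop hR₀ hκ hr h2r, h1,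
    Real.sq_sqrt hu.le]

/-- `⟨1/|∇Ψ|²⟩ = ∫ w/lcGradSq dt ÷ ∫ w dt`. [cite: Jardin2010, §8.5 eq. (8.134)] -/
theorem surfaceAverageE_lcLoop_invGradSq {R₀ κ FB q₀ r : ℝ} (hR₀ : 0 < R₀) (hκ : 0 < κ) (hFB : 0 < FB)
    (hq₀ : 0 < q₀) (hr : 0 < r) (h2r : 2 * r < R₀) (a : ℝ) :
    surfaceAverageE (psiLC κ FB R₀ q₀ a) (lcLoop R₀ κ r) (2 * π)
        (fun R Z => 1 / gradSq (psiLC κ FB R₀ q₀ a) R Z)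
      = (∫ t in (0 : ℝ)..(2 * π), lcAvgWeight κ FB R₀ q₀ r t / lcGradSq κ FB R₀ q₀ r t)
          / ∫ t in (0 : ℝ)..(2 * π), lcAvgWeight κ FB R₀ q₀ r t := by
  rw [surfaceAverageE_lcLoop hR₀ hκ hFB hq₀ hr h2r a]
  congr 1
  exact intervalIntegral.integral_congr fun t _ => by
    rw [gradSq_psiLC_lcLoop hR₀ hκ.ne' hr.le h2r]; ring

/-- `⟨B²/|∇Ψ|²⟩ = ∫ (g² + G)/(u·G)·w dt ÷ ∫ w dt`, `G = lcGradSq` (constant `F ≡ g`). [cite: Jardin2010, §8.5 eq. (8.134)] -/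
theorem surfaceAverageE_lcLoop_bsqDivGradSq {R₀ κ FB q₀ r : ℝ} (hR₀ : 0 < R₀) (hκ : 0 < κ)
    (hFB : 0 < FB) (hq₀ : 0 < q₀) (hr : 0 < r) (h2r : 2 * r < R₀) (g a : ℝ) :
    surfaceAverageE (psiLC κ FB R₀ q₀ a) (lcLoop R₀ κ r) (2 * π)
        (fun R Z => fieldBsq (fun _ => g) (psiLC κ FB R₀ q₀ a) R Z / gradSq (psiLC κ FB R₀ q₀ a) R Z)
      = (∫ t in (0 : ℝ)..(2 * π), (g ^ 2 + lcGradSq κ FB R₀ q₀ r t)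
            / (lcU R₀ r t * lcGradSq κ FB R₀ q₀ r t) * lcAvgWeight κ FB R₀ q₀ r t)
          / ∫ t in (0 : ℝ)..(2 * π), lcAvgWeight κ FB R₀ q₀ r t := by
  rw [surfaceAverageE_lcLoop hR₀ hκ hFB hq₀ hr h2r a]
  congr 1
  exact intervalIntegral.integral_congr fun t _ => by
    rw [fieldBsq_lcLoop hR₀ hκ.ne' hr.le h2r, gradSq_psiLC_lcLoop hR₀ hκ.ne' hr.le h2r, div_div]

/-- `⟨1/B²⟩ = ∫ u/(g² + G)·w dt ÷ ∫ w dt` (constant `F ≡ g`). [cite: Jardin2010, §8.5 eq. (8.134)] -/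
theorem surfaceAverageE_lcLoop_invBsq {R₀ κ FB q₀ r : ℝ} (hR₀ : 0 < R₀) (hκ : 0 < κ) (hFB : 0 < FB)
    (hq₀ : 0 < q₀) (hr : 0 < r) (h2r : 2 * r < R₀) (g a : ℝ) :
    surfaceAverageE (psiLC κ FB R₀ q₀ a) (lcLoop R₀ κ r) (2 * π)
        (fun R Z => 1 / fieldBsq (fun _ => g) (psiLC κ FB R₀ q₀ a) R Z)
      = (∫ t in (0 : ℝ)..(2 * π), lcU R₀ r t / (g ^ 2 + lcGradSq κ FB R₀ q₀ r t)
            * lcAvgWeight κ FB R₀ q₀ r t)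
          / ∫ t in (0 : ℝ)..(2 * π), lcAvgWeight κ FB R₀ q₀ r t := by
  rw [surfaceAverageE_lcLoop hR₀ hκ hFB hq₀ hr h2r a]
  congr 1
  exact intervalIntegral.integral_congr fun t _ => by
    rw [fieldBsq_lcLoop hR₀ hκ.ne' hr.le h2r, one_div, inv_div]

/-- `⟨1/(B²|∇Ψ|²)⟩ = ∫ u/((g² + G)·G)·w dt ÷ ∫ w dt` (constant `F ≡ g`). [cite: Jardin2010, §8.5 eq. (8.134)] -/
theorem surfaceAverageE_lcLoop_invBsqGradSq {R₀ κ FB q₀ r : ℝ} (hR₀ : 0 < R₀) (hκ : 0 < κ)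
    (hFB : 0 < FB) (hq₀ : 0 < q₀) (hr : 0 < r) (h2r : 2 * r < R₀) (g a : ℝ) :
    surfaceAverageE (psiLC κ FB R₀ q₀ a) (lcLoop R₀ κ r) (2 * π)
        (fun R Z => 1 / (fieldBsq (fun _ => g) (psiLC κ FB R₀ q₀ a) R Z * gradSq (psiLC κ FB R₀ q₀ a) R Z))
      = (∫ t in (0 : ℝ)..(2 * π), lcU R₀ r t
            / ((g ^ 2 + lcGradSq κ FB R₀ q₀ r t) * lcGradSq κ FB R₀ q₀ r t) * lcAvgWeight κ FB R₀ q₀ r t)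
          / ∫ t in (0 : ℝ)..(2 * π), lcAvgWeight κ FB R₀ q₀ r t := by
  rw [surfaceAverageE_lcLoop hR₀ hκ hFB hq₀ hr h2r a]
  congr 1
  refine intervalIntegral.integral_congr fun t _ => ?_
  have hu := lcU_pos hR₀ hr.le h2r t
  rw [fieldBsq_lcLoop hR₀ hκ.ne' hr.le h2r, gradSq_psiLC_lcLoop hR₀ hκ.ne' hr.le h2r]
  field_simp

/-- `⟨R⁻²⟩ = ∫ w/u dt ÷ ∫ w dt` (the average in Jardin's `Φ′` (5.31) and `q` (5.35)).
[cite: Jardin2010, §5.3 eq. (5.35)] -/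
theorem surfaceAverageE_lcLoop_invRsq {R₀ κ FB q₀ r : ℝ} (hR₀ : 0 < R₀) (hκ : 0 < κ) (hFB : 0 < FB)
    (hq₀ : 0 < q₀) (hr : 0 < r) (h2r : 2 * r < R₀) (a : ℝ) :
    surfaceAverageE (psiLC κ FB R₀ q₀ a) (lcLoop R₀ κ r) (2 * π) (fun R _ => (R ^ 2)⁻¹)
      = (∫ t in (0 : ℝ)..(2 * π), lcAvgWeight κ FB R₀ q₀ r t / lcU R₀ r t)
          / ∫ t in (0 : ℝ)..(2 * π), lcAvgWeight κ FB R₀ q₀ r t := by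
  rw [surfaceAverageE_lcLoop hR₀ hκ hFB hq₀ hr h2r a]
  congr 1
  refine intervalIntegral.integral_congr fun t _ => ?_
  have hu := lcU_pos hR₀ hr.le h2r t
  have h1 : (lcLoop R₀ κ r t).1 = Real.sqrt (lcU R₀ r t) := rfl
  rw [h1, Real.sq_sqrt hu.le, div_eq_mul_inv, mul_comm]

end Literature.MathematicalPhysics.MHD.Solovev
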